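import Summits.BirchSwinnertonDyer.BirchSwinnertonDyer.Theorems.ByReductionTypeAtTwoRankOneAtTwoBigImageOddLocalOneDoorFullC
import Summits.BirchSwinnertonDyer.BirchSwinnertonDyer.Theorems.ByReductionTypeAtTwoRankOneAtTwoBigImageOddLocalOneDoorPrimaryDoor
import Literature.NumberTheory.EllipticCurves.Rank1Residual.Typed.Basic
import HarnessLib

/-!
# Route ByReductionTypeAtTwo, crux `RankOneAtTwoBigImageOddLocal` (stmt-BirchSwinnertonDyer-23715), LINE v8.5 `one_door_analytic`:
# `#Ш_an(W)` in door currency — the `2`-adic VALUATION at a door datum as a standalone equation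

Width prover seat `bsd-line-fkl-p2` g8 (2026-08-28), `--supports stmt-BirchSwinnertonDyer-23715`.  THEOREMS ONLY; nothing is
asserted; BSD is not proved by any of this.

The line of record reduces the crux to ONE conjecture, AN-28c `DoorIndexLawFullCAtTwo` (`…OneDoorLawCDefs.lean`): at every
non-vanishing door datum `2m + [Δ_W<0] = s_E + s_d + t + 2s + 2·v₂(c)`, and the per-datum kernel iff
`bsdp_two_iff_doorLawFullC_at[_of_rank]` (`…OneDoorFullC.lean` p621746, `…OneDoorFullCPrimary.lean` p623374) says this identity IS
`BSD₂(W)` modulo print and `BSD₂` of the twin.  Inside that proof sits a sharper fact, stated here on its own so that the ONE-SIDED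
laws (the halves, `…OneDoorHalves.lean`) and the `2`-integrality residue become corollaries:

* `doorValuationC_at` — **the `2`-adic valuation of `#Ш_an(W)` in door currency.**  `W/ℚ` globally minimal, odd `#E(ℚ)_tors`, odd
  `∏ c_ℓ`, analytic rank `1`, `rank E(ℚ) = 1`; `K` imaginary quadratic with door-admissible `d_K`, Heegner hypothesis,
  `L(E^{(d_K)},1) ≠ 0`; ANY parametrisation datum `Dt` (constant `c`), `H`, `ι`, the `K`-rational Heegner point `P`; a globally
  minimal model `Wd` of the twist WITH `BSD(Wd, 2)`; Gross–Zagier / Kolyvagin at `(N_E, W, K)`, modularity, the proved Tamagawa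
  receptacle `DoorTwistTamagawaAtTwo` (p616165).  THEN `Ш(W)` is finite, `rank E(K) = 1`, the Heegner point has infinite order and a
  UNIQUE exact `2`-divisibility exponent `m` modulo torsion, and `#Ш_an(W)` is a non-zero rational `q` with
  **`ord₂ q = 2m + [Δ_W<0] − s_d − t − 2s − 2·v₂(c)`** (`s_d = ord₂ #Ш(Wd)[2^∞]`).  So AN-28c at the datum reads
  `ord₂ #Ш_an(W) = s_E` — which is `bsdp_two_iff_doorLawFullC_at` again — and each INEQUALITY between the two sides of AN-28c is
  one half of `BSD₂(W)` in Miller's currency (`Typed.MissingUpperBoundAt` / `MissingLowerBoundAt`, companion file).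
* `hasTwoDivisibilityUpToTorsion_unique` — bookkeeping: in rank one the exponent is unique (`ord₂ [E(K):ℤP] = m + ord₂ #E(K)_tors`,
  `padicValNat_index_of_twoDivisibility`), so «`∃ m`, exponent `∧` law(`m`)» and «`∀ m`, exponent `→` law(`m`)» agree.

Proof of the valuation: Gross–Zagier in the explicit form `#Ш_an(W) = 8 I² t_W² / (n k² t_K² c² w² q_d |u| c_W)`
(`shaAn_eq_heegnerIndexFormula_two_of_rank`, p620211), `k = 1` (odd `#E(K)_tors`), `w = 2`, `|u| = 1`, `ord₂ I = m`,
`ord₂ q_d = s_d + t + 2s` (`BSD(Wd,2)` in rank `0`, odd `#Wd(ℚ)_tors`, twist Tamagawa arithmetic), `ord₂ n + [Δ<0] = 1` — the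
bookkeeping of the lead's `bsdp_two_iff_doorLawFullC_at` verbatim, stopped one step before the comparison with `s_E`.

References: [GrossZagier1986] Thm. I.6.3, V.§2; [GrossLMS1991] §2 Conj. (2.2); [Miller2011LMS] Def. 1.1.
-/

set_option autoImplicit false

noncomputable section

open scoped Classical

set_option linter.dupNamespace false

namespace Summit.BirchSwinnertonDyer.BirchSwinnertonDyer.Theorems.RankOneAtTwoOneDoor

open WeierstrassCurve NumberField IsDedekindDomain Rat.HeightOneSpectrum Literature.NumberTheory.EllipticCurves
  Literature.NumberTheory.EllipticCurves.ModularForms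
  Literature.NumberTheory.EllipticCurves.KrizLi2019
  Literature.NumberTheory.EllipticCurves.Rank1Residual.Typed
  Summit.BirchSwinnertonDyer.Rank1Residual.F1Sign2
  Summit.BirchSwinnertonDyer.Rank1Residual.F1Sign2.TranspositionDoor
  Summit.BirchSwinnertonDyer.Rank1Residual

/-! ### §0 Bookkeeping: the exact `2`-divisibility exponent modulo torsion is unique in rank one -/

/-- In a rank-one group `V(K)` (every point a multiple of `g` modulo torsion) the exponent `m` with `P ≡ 2^m Q`, `Q` not twice a
point modulo torsion, is determined by `P`: `ord₂ [V(K):ℤP] = m + ord₂ #V(K)_tors` (`padicValNat_index_of_twoDivisibility`). [folklore] -/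
theorem twoDivisibility_exponent_unique {K : Type} [Field K] [NumberField K] (V : WeierstrassCurve K) [V.IsElliptic]
    {g : V.toAffine.Point} (hg : ¬ IsOfFinAddOrder g)
    (hgen : ∀ y : V.toAffine.Point, ∃ n : ℤ, y - n • g ∈ AddCommGroup.torsion V.toAffine.Point)
    {P Q Q' : V.toAffine.Point} {m m' : ℕ}
    (hPQ : P - (2 ^ m) • Q ∈ AddCommGroup.torsion V.toAffine.Point)
    (hQ : ¬ ∃ R : V.toAffine.Point, Q - 2 • R ∈ AddCommGroup.torsion V.toAffine.Point)
    (hPQ' : P - (2 ^ m') • Q' ∈ AddCommGroup.torsion V.toAffine.Point)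
    (hQ' : ¬ ∃ R : V.toAffine.Point, Q' - 2 • R ∈ AddCommGroup.torsion V.toAffine.Point) : m = m' := by
  have h1 := (padicValNat_index_of_twoDivisibility V hg hgen hPQ hQ).2
  have h2 := (padicValNat_index_of_twoDivisibility V hg hgen hPQ' hQ').2
  omega

/-- On `W ⊗ K` of Mordell–Weil rank one the predicate `HasTwoDivisibilityUpToTorsion W K P m` holds for at most one `m`. [folklore] -/
theorem hasTwoDivisibilityUpToTorsion_unique (W : WeierstrassCurve ℚ) [W.IsElliptic] (K : Type) [Field K] [NumberField K]
    (hrkK : (W.baseChange K).mordellWeilRank = 1) (P : (W.baseChange K).toAffine.Point) {m m' : ℕ}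
    (hm : HasTwoDivisibilityUpToTorsion W K P m) (hm' : HasTwoDivisibilityUpToTorsion W K P m') : m = m' := by
  haveI hEK : (W.baseChange K).IsElliptic := isElliptic_baseChange' W K
  obtain ⟨gK, hgK, hgenK, -, -⟩ := exists_generator_regulator_eq_of_mordellWeilRank_eq_one (W.baseChange K) hrkK
  obtain ⟨Q, hPQ, hQ⟩ := hm
  obtain ⟨Q', hPQ', hQ'⟩ := hm'
  exact twoDivisibility_exponent_unique (W.baseChange K) hgK hgenK hPQ hQ hPQ' hQ'

/-! ### §1 The valuation of `#Ш_an(W)` in door currency -/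

/-- **`ord₂ #Ш_an(W)` IN DOOR CURRENCY, parametrisation constant floating.**  `W/ℚ` globally minimal, odd `#E(ℚ)_tors` (`hT`), odd
`∏ c_ℓ` (`hc`), analytic rank `1` (`hr`), `rank E(ℚ) = 1` (`hrQ`); `K` imaginary quadratic with `d_K` door-admissible, the Heegner
hypothesis for `N_E` and `L(E^{(d_K)},1) ≠ 0`; `Dt` ANY parametrisation datum of level `N_E` (`c = Dt.c ≠ 0` by
`maninConstant_ne_zero_holds`, no parity assumed), `H`, `ι`, `P ∈ E(K)` mapping to the complex Heegner point; `Wd` a globally minimal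
model of the twist WITH `BSD(Wd, 2)`; published inputs Gross–Zagier / Kolyvagin at `(N_E, W, K)` and modularity; the proved Tamagawa
receptacle `DoorTwistTamagawaAtTwo`.  THEN: `Ш(W)` and `Ш(Wd)[2^∞]` are finite, `rank E(K) = 1`, `P` has infinite order and an exact
`2`-divisibility exponent modulo torsion, that exponent is unique, and `#Ш_an(W)` is a non-zero rational `q` with, for the exponent `m`,
`ord₂ q = 2m + [Δ_W < 0] − s_d − t − 2s − 2·v₂(c)` (`s_d = ord₂ #Ш(Wd)[2^∞]`, `t`/`s` the transposition/identity counts of `d_K`).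
Proof: Gross–Zagier in the explicit form `#Ш_an(W) = 8 I² t_W² / (n k² t_K² c² w² q_d |u| c_W)` (`shaAn_eq_heegnerIndexFormula_two_of_rank`),
`k = 1` (odd `#E(K)_tors`), `w = 2`, `|u| = 1`, `ord₂ I = m` (`padicValNat_index_of_twoDivisibility`), `ord₂ q_d = s_d + t + 2s`
(`BSD(Wd,2)` in rank `0`, odd `#Wd(ℚ)_tors`, the twist Tamagawa arithmetic), `ord₂ n + [Δ<0] = 1` — the bookkeeping of
`bsdp_two_iff_doorLawFullC_at` (lead g7, p621746) verbatim, stopped one step earlier.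
[cite: GrossZagier1986, Thm. I.6.3 and V.§2] [cite: Miller2011LMS, Def. 1.1] -/
theorem doorValuationC_at
    (hmod : hasEntireLFunction_rat) (hTam : DoorTwistTamagawaAtTwo)
    (W : WeierstrassCurve ℚ) [W.IsElliptic] [W.IsGloballyMinimal] [NeZero (W.conductorNorm ℤ)]
    (hT : Odd W.torsionOrder) (hc : Odd W.tamagawaProduct) (hr : W.analyticRank = 1) (hrQ : W.mordellWeilRank = 1)
    (K : Type) [Field K] [NumberField K] (hK : IsImaginaryQuadratic K)
    (hGZ : gross_zagier (W.conductorNorm ℤ) W K) (hKo : kolyvagin (W.conductorNorm ℤ) W K)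
    (hadm : DoorAdmissible W (NumberField.discr K))
    (hHN : SatisfiesHeegnerHypothesis (W.conductorNorm ℤ) K)
    (hLt : (W.quadraticTwist (NumberField.discr K : ℚ)).entireLFunction 1 ≠ 0)
    (Dt : ModularParametrizationData W (W.conductorNorm ℤ))
    (H : HeegnerDatum (W.conductorNorm ℤ) (NumberField.discr K)) (ι : K →+* ℂ)
    (P : (W.baseChange K).toAffine.Point)
    (hP : WeierstrassCurve.Affine.Point.map ι.toRatAlgHom P = heegnerPointComplex Dt H)
    (Wd : WeierstrassCurve ℚ) [Wd.IsElliptic] [Wd.IsGloballyMinimal] (Cd : VariableChange ℚ)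
    (hWd : Cd • W.quadraticTwist (NumberField.discr K : ℚ) = Wd) (hBd : BSDp Wd 2) :
    Finite W.sha ∧ Finite (AddCommGroup.primaryComponent Wd.sha 2) ∧
      (W.baseChange K).mordellWeilRank = 1 ∧ ¬ IsOfFinAddOrder P ∧
      (∃ m : ℕ, HasTwoDivisibilityUpToTorsion W K P m) ∧
      (∀ m m' : ℕ, HasTwoDivisibilityUpToTorsion W K P m → HasTwoDivisibilityUpToTorsion W K P m' → m = m') ∧
      ∃ q : ℚ, shaAn W = (q : ℂ) ∧ q ≠ 0 ∧
        ∀ m : ℕ, HasTwoDivisibilityUpToTorsion W K P m →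
          padicValRat 2 q =
            2 * (m : ℤ) + ((if W.Δ < 0 then 1 else 0 : ℕ) : ℤ) -
              (padicValNat 2 (Nat.card (AddCommGroup.primaryComponent Wd.sha 2)) : ℤ) -
              (transpCount W (NumberField.discr K) : ℤ) - 2 * (identCount W (NumberField.discr K) : ℤ) -
              2 * (padicValInt 2 Dt.c : ℤ) := by
  haveI : Fact (Nat.Prime 2) := ⟨Nat.prime_two⟩
  have hT2 : NoRationalTwoTorsion W := noRationalTwoTorsion_of_odd_torsionOrder W hT
  have h2 : Module.finrank ℚ K = 2 := hK.1
  haveI : IsTotallyComplex K := hK.2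
  -- the twist model: `L(Wd,1) ≠ 0`, analytic rank `0`, `BSD(Wd,2)` unpacked in rank `0`
  have hD0 : (NumberField.discr K : ℚ) ≠ 0 := by exact_mod_cast NumberField.discr_ne_zero K
  haveI hEt : (W.quadraticTwist (NumberField.discr K : ℚ)).IsElliptic := W.isElliptic_quadraticTwist hD0
  have hLeq : Wd.entireLFunction = (W.quadraticTwist (NumberField.discr K : ℚ)).entireLFunction := by
    rw [← hWd, entireLFunction_smul]
  have hLd : Wd.entireLFunction 1 ≠ 0 := by rw [hLeq]; exact hLt
  have hrd : Wd.analyticRank = 0 := (Wd.analyticRank_eq_zero_iff_holds (hmod Wd)).2 hLd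
  obtain ⟨hrankd, hfind, q', hq', hv'⟩ := hBd
  haveI := hfind
  have hrkd : Wd.mordellWeilRank = 0 := by rw [hrankd, hrd]
  -- `Wd(ℚ)[2] = 0` (twist invariance of `E(ℚ)[2] = 0`), hence `#Wd(ℚ)_tors` odd
  have hW2 : ∀ T : W.toAffine.Point, 2 • T = 0 → T = 0 := EggDoubling.eq_zero_of_two_smul_eq_zero W hT2
  have hWd2 : ∀ T : Wd.toAffine.Point, 2 • T = 0 → T = 0 := by
    have hbotW : AddSubgroup.torsionBy W.toAffine.Point (2 : ℤ) = ⊥ :=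
      Summit.BirchSwinnertonDyer.Uniform.U2.torsionBy_two_eq_bot_iff.mpr hW2
    have hbotWd := Summit.BirchSwinnertonDyer.Uniform.U2.torsionBy_two_eq_bot_of_twist W hD0 Wd ⟨Cd⁻¹, by
      rw [← hWd, inv_smul_smul]⟩ hbotW
    exact Summit.BirchSwinnertonDyer.Uniform.U2.torsionBy_two_eq_bot_iff.mp hbotWd
  have hTdodd : Odd Wd.torsionOrder := by
    rw [← Nat.not_even_iff_odd, even_iff_two_dvd]
    intro hdvd
    obtain ⟨T, hT'⟩ := exists_addOrderOf_eq_of_dvd_torsionOrder Wd 2 hdvd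
    have h2T : 2 • T = 0 := by
      have h := addOrderOf_nsmul_eq_zero T
      rwa [hT'] at h
    have hT0 : T = 0 := hWd2 T h2T
    rw [hT0, addOrderOf_zero] at hT'
    exact absurd hT' (by norm_num)
  have hvTd : padicValNat 2 Wd.torsionOrder = 0 :=
    padicValNat.eq_zero_of_not_dvd (fun h => (Nat.not_even_iff_odd.mpr hTdodd) (even_iff_two_dvd.mpr h))
  -- the value `q_d = L(Wd,1)/Ω(Wd)` and its valuation `s_d + ord₂ ∏c_ℓ(Wd) - 2 ord₂ #T`
  have hlead : Wd.leadingLCoeff = Wd.entireLFunction 1 :=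
    WeierstrassCurve.leadingLCoeff_eq_of_analyticRank_eq_zero Wd hrd
  have hreg : Wd.regulator = 1 := Wd.regulator_eq_one_of_rank_zero hrkd
  have hΩdpos : 0 < Wd.realPeriodRat := Wd.realPeriodRat_pos_holds
  have hΩdC : (Wd.realPeriodRat : ℂ) ≠ 0 := by exact_mod_cast hΩdpos.ne'
  have hTd0 : 0 < Wd.torsionOrder := Wd.torsionOrder_pos_holds
  have hcd0 : 0 < Wd.tamagawaProduct := Wd.tamagawaProduct_pos_holds
  set qd : ℚ := q' * Wd.tamagawaProduct / (Wd.torsionOrder : ℚ) ^ 2 with hqd_def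
  have hsha := hq'
  rw [shaAn_def, hlead, hreg, Complex.ofReal_one, mul_one] at hsha
  have hqd : Wd.entireLFunction 1 / (Wd.realPeriodRat : ℂ) = (qd : ℂ) := by
    have hTC : (Wd.torsionOrder : ℂ) ≠ 0 := by exact_mod_cast hTd0.ne'
    have hcC : (Wd.tamagawaProduct : ℂ) ≠ 0 := by exact_mod_cast hcd0.ne'
    have h1 : Wd.entireLFunction 1 * (Wd.torsionOrder : ℂ) ^ 2 =
        (q' : ℂ) * ((Wd.realPeriodRat : ℂ) * (Wd.tamagawaProduct : ℂ)) := by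
      rw [← hsha]; field_simp
    rw [hqd_def]
    push_cast
    field_simp
    linear_combination h1
  have hq'0 : q' ≠ 0 := by
    intro h0
    apply hLd
    have := hqd
    rw [hqd_def, h0, zero_mul, zero_div, Rat.cast_zero, div_eq_zero_iff] at this
    rcases this with h | h
    · exact h
    · exact absurd h hΩdC
  have hTq : (Wd.torsionOrder : ℚ) ≠ 0 := by exact_mod_cast hTd0.ne'
  have hcq : (Wd.tamagawaProduct : ℚ) ≠ 0 := by exact_mod_cast hcd0.ne'
  have hqd0 : qd ≠ 0 := by
    rw [hqd_def]; exact div_ne_zero (mul_ne_zero hq'0 hcq) (pow_ne_zero _ hTq)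
  have hvqd : padicValRat 2 qd =
      (padicValNat 2 (Nat.card (AddCommGroup.primaryComponent Wd.sha 2)) : ℤ) +
        padicValNat 2 W.tamagawaProduct + transpCount W (NumberField.discr K) + 2 * identCount W (NumberField.discr K) := by
    rw [hqd_def, padicValRat.div (mul_ne_zero hq'0 hcq) (pow_ne_zero _ hTq), padicValRat.mul hq'0 hcq,
      padicValRat.pow, padicValRat.of_nat, padicValRat.of_nat, hv', hvTd, hTam W (NumberField.discr K) hadm Wd Cd hWd]
    push_cast
    ring
  have hc0 : Dt.c ≠ 0 := Dt.maninConstant_ne_zero_holds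
  -- Gross–Zagier in the explicit `2`-adic form: `#Ш_an(W) = 8 I² t_W² / (n k² t_K² c² w² q_d |u| c_W)`
  obtain ⟨hfinW, k, hk12, hkiff, hshaW⟩ :=
    shaAn_eq_heegnerIndexFormula_two_of_rank W (W.conductorNorm ℤ) K Dt H ι P hGZ hKo hmod hK hHN hP hc0 hr hrQ hLt Wd Cd
      hWd qd hqd
  haveI := hfinW
  ------------------------------------------------------------------ rank `E(K) = 1`, `P` of infinite order
  haveI hEK : (W.baseChange K).IsElliptic := isElliptic_baseChange' W K
  have hL0 : W.entireLFunction 1 = 0 := entireLFunction_one_eq_zero_of_analyticRank_eq_one hr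
  obtain ⟨-, hderiv⟩ := leadingLCoeff_eq_deriv_of_analyticRank_eq_one hr
  have hprod := lDerivEK_eq_deriv_mul W K hmod hL0
  have hLK : LDerivEK W K ≠ 0 := by rw [hprod]; exact mul_ne_zero hderiv hLt
  have hPH : IsHeegnerPoint (W.conductorNorm ℤ) W K P := ⟨Dt, H, ι, hP⟩
  have hPinf : ¬ IsOfFinAddOrder P :=
    (lDerivEK_ne_zero_iff_not_isOfFinAddOrder W (W.conductorNorm ℤ) K hGZ hK hHN hPH).mp hLK
  obtain ⟨hrkK, -⟩ := hKo hK hHN hPH hPinf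
  have hrk : W.mordellWeilRank = 1 := hrQ
  ------------------------------------------------------------------ `#E(K)_tors` odd, `k = 1`
  have htKodd : Odd (W.baseChange K).torsionOrder := odd_torsionOrder_baseChange_of_noRationalTwoTorsion W hT2 K h2
  have hk1 : k = 1 := by
    rcases hk12 with h | h
    · exact h
    · exact absurd (hkiff.mp h) (P2.not_forall_halvable_of_odd_torsionOrder W K h2 hrkK hrk htKodd)
  have hvtK : padicValNat 2 (W.baseChange K).torsionOrder = 0 :=
    padicValNat.eq_zero_of_not_dvd (fun h => (Nat.not_even_iff_odd.mpr htKodd) (even_iff_two_dvd.mpr h))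
  ------------------------------------------------------------------ the generator of `E(K)/tors`
  obtain ⟨gK, hgK, hgenK, huniqK, -⟩ :=
    exists_generator_regulator_eq_of_mordellWeilRank_eq_one (W.baseChange K) hrkK
  ------------------------------------------------------------------ `w_K = 2`, `|u| = 1`, oddness
  have hw2 : Units.torsionOrder K = 2 :=
    Literature.NumberTheory.QuadraticFields.Quadratic.torsionOrder_eq_two_of_discr_lt_neg_four h2
      (discr_lt_neg_four_of_doorAdmissible hadm)
  have hu1 : |(Cd.u : ℚ)| = 1 := by
    rcases W.u_eq_one_or_eq_neg_one_of_smul_quadraticTwist_of_squarefree (emod_four_of_doorAdmissible hadm)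
        hadm.2.1 (good_or_mult_at_dvd_of_doorAdmissible W hadm) Wd Cd hWd with h | h <;> rw [h] <;> simp
  have hvcWn : padicValNat 2 W.tamagawaProduct = 0 :=
    padicValNat.eq_zero_of_not_dvd (fun h => (Nat.not_even_iff_odd.mpr hc) (even_iff_two_dvd.mpr h))
  ------------------------------------------------------------------ the valuation, for ANY exponent `m` of `P`
  have hΔ0 : W.Δ ≠ 0 := W.isUnit_Δ.ne_zero
  have htW' : (W.torsionOrder : ℚ) ≠ 0 := by exact_mod_cast (W.torsionOrder_pos_holds).ne'
  have htK' : ((W.baseChange K).torsionOrder : ℚ) ≠ 0 := by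
    exact_mod_cast ((W.baseChange K).torsionOrder_pos_holds).ne'
  have hcW' : (W.tamagawaProduct : ℚ) ≠ 0 := by exact_mod_cast (W.tamagawaProduct_pos_holds).ne'
  have hcM : (Dt.c : ℚ) ≠ 0 := by exact_mod_cast hc0
  have hw' : (Units.torsionOrder K : ℚ) ≠ 0 := by rw [hw2]; norm_num
  have hua : |(Cd.u : ℚ)| ≠ 0 := abs_ne_zero.mpr Cd.u.ne_zero
  have hk' : ((k : ℕ) : ℚ) ≠ 0 := by rw [hk1]; norm_num
  have hn12 : (W.baseChange ℝ).numRealComponents = 1 ∨ (W.baseChange ℝ).numRealComponents = 2 :=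
    numRealComponents_eq_one_or W
  have hn' : ((W.baseChange ℝ).numRealComponents : ℚ) ≠ 0 := by
    rcases hn12 with h | h <;> rw [h] <;> norm_num
  have h8 : padicValRat 2 (8 : ℚ) = 3 := by
    rw [show (8 : ℚ) = ((2 : ℕ) : ℚ) ^ 3 by norm_num, padicValRat.pow, padicValRat.self one_lt_two]; norm_num
  have hvtW : padicValRat 2 (W.torsionOrder : ℚ) = 0 := by
    rw [padicValRat.of_nat, padicValNat.eq_zero_of_not_dvd
      (fun h => (Nat.not_even_iff_odd.mpr hT) (even_iff_two_dvd.mpr h))]; rfl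
  have hvtKq : padicValRat 2 ((W.baseChange K).torsionOrder : ℚ) = 0 := by
    rw [padicValRat.of_nat, hvtK]; rfl
  have hvcW : padicValRat 2 (W.tamagawaProduct : ℚ) = 0 := by
    rw [padicValRat.of_nat, hvcWn]; rfl
  have hvc : padicValRat 2 (Dt.c : ℚ) = (padicValInt 2 Dt.c : ℤ) := padicValRat.of_int
  have hvw : padicValRat 2 (Units.torsionOrder K : ℚ) = 1 := by
    rw [hw2]; exact padicValRat.self one_lt_two
  have hvu : padicValRat 2 |(Cd.u : ℚ)| = 0 := by rw [hu1]; exact padicValRat.one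
  have hvk : padicValRat 2 ((k : ℕ) : ℚ) = 0 := by
    rw [hk1, Nat.cast_one]; exact padicValRat.one
  have hvqd' : padicValRat 2 qd =
      (padicValNat 2 (Nat.card (AddCommGroup.primaryComponent Wd.sha 2)) : ℤ) +
        ((transpCount W (NumberField.discr K) : ℤ) + 2 * (identCount W (NumberField.discr K) : ℤ)) := by
    rw [hvqd, hvcWn]; push_cast; ring
  have hD1 : ((W.baseChange ℝ).numRealComponents : ℚ) * ((k : ℕ) : ℚ) ^ 2 ≠ 0 :=
    mul_ne_zero hn' (pow_ne_zero _ hk')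
  have hD2 : ((W.baseChange ℝ).numRealComponents : ℚ) * ((k : ℕ) : ℚ) ^ 2 *
      ((W.baseChange K).torsionOrder : ℚ) ^ 2 ≠ 0 := mul_ne_zero hD1 (pow_ne_zero _ htK')
  have hD3 : ((W.baseChange ℝ).numRealComponents : ℚ) * ((k : ℕ) : ℚ) ^ 2 *
      ((W.baseChange K).torsionOrder : ℚ) ^ 2 * (Dt.c : ℚ) ^ 2 ≠ 0 := mul_ne_zero hD2 (pow_ne_zero _ hcM)
  have hD4 : ((W.baseChange ℝ).numRealComponents : ℚ) * ((k : ℕ) : ℚ) ^ 2 *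
      ((W.baseChange K).torsionOrder : ℚ) ^ 2 * (Dt.c : ℚ) ^ 2 * (Units.torsionOrder K : ℚ) ^ 2 ≠ 0 :=
    mul_ne_zero hD3 (pow_ne_zero _ hw')
  have hD5 : ((W.baseChange ℝ).numRealComponents : ℚ) * ((k : ℕ) : ℚ) ^ 2 *
      ((W.baseChange K).torsionOrder : ℚ) ^ 2 * (Dt.c : ℚ) ^ 2 * (Units.torsionOrder K : ℚ) ^ 2 * qd ≠ 0 :=
    mul_ne_zero hD4 hqd0
  have hD6 : ((W.baseChange ℝ).numRealComponents : ℚ) * ((k : ℕ) : ℚ) ^ 2 *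
      ((W.baseChange K).torsionOrder : ℚ) ^ 2 * (Dt.c : ℚ) ^ 2 * (Units.torsionOrder K : ℚ) ^ 2 * qd *
      |(Cd.u : ℚ)| ≠ 0 := mul_ne_zero hD5 hua
  have hD7 : ((W.baseChange ℝ).numRealComponents : ℚ) * ((k : ℕ) : ℚ) ^ 2 *
      ((W.baseChange K).torsionOrder : ℚ) ^ 2 * (Dt.c : ℚ) ^ 2 * (Units.torsionOrder K : ℚ) ^ 2 * qd *
      |(Cd.u : ℚ)| * (W.tamagawaProduct : ℚ) ≠ 0 := mul_ne_zero hD6 hcW'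
  have hden : padicValRat 2 (((W.baseChange ℝ).numRealComponents : ℚ) * ((k : ℕ) : ℚ) ^ 2 *
      ((W.baseChange K).torsionOrder : ℚ) ^ 2 * (Dt.c : ℚ) ^ 2 * (Units.torsionOrder K : ℚ) ^ 2 * qd *
      |(Cd.u : ℚ)| * (W.tamagawaProduct : ℚ)) =
      padicValRat 2 ((W.baseChange ℝ).numRealComponents : ℚ) + 2 + 2 * (padicValInt 2 Dt.c : ℤ) +
        ((padicValNat 2 (Nat.card (AddCommGroup.primaryComponent Wd.sha 2)) : ℤ) +
          ((transpCount W (NumberField.discr K) : ℤ) + 2 * (identCount W (NumberField.discr K) : ℤ))) := by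
    rw [padicValRat.mul hD6 hcW', padicValRat.mul hD5 hua, padicValRat.mul hD4 hqd0,
      padicValRat.mul hD3 (pow_ne_zero _ hw'), padicValRat.mul hD2 (pow_ne_zero _ hcM),
      padicValRat.mul hD1 (pow_ne_zero _ htK'), padicValRat.mul hn' (pow_ne_zero _ hk'),
      padicValRat.pow, padicValRat.pow, padicValRat.pow, padicValRat.pow,
      hvk, hvtKq, hvc, hvw, hvqd', hvu, hvcW]
    ring
  -- `[Δ<0]` and `v₂ n` add up to `1`
  have hsign : padicValRat 2 ((W.baseChange ℝ).numRealComponents : ℚ) + (if W.Δ < 0 then 1 else 0 : ℕ) = 1 := by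
    rcases lt_or_gt_of_ne hΔ0 with hneg | hpos
    · rw [if_pos hneg, P2.numRealComponents_eq_one_of_Δ_neg hneg, Nat.cast_one, padicValRat.one]; norm_num
    · rw [if_neg (not_lt.mpr hpos.le), P2.numRealComponents_eq_two_of_Δ_pos hpos, padicValRat.self one_lt_two]
      norm_num
  -- `#Ш_an(W) ≠ 0` (modularity: `L^*(E,1) ≠ 0`; the BSD denominators are positive)
  have hshaW_ne : shaAn W ≠ 0 := by
    rw [shaAn_def]
    refine div_ne_zero (mul_ne_zero (W.leadingLCoeff_ne_zero_holds (hmod W))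
      (pow_ne_zero 2 (by exact_mod_cast W.torsionOrder_pos_holds.ne'))) ?_
    exact mul_ne_zero (mul_ne_zero (by exact_mod_cast W.realPeriodRat_pos_holds.ne')
      (by exact_mod_cast W.tamagawaProduct_pos_holds.ne')) (by exact_mod_cast W.regulator_pos'.ne')
  -- the door's rational
  set q : ℚ := 8 * ((AddSubgroup.zmultiples P).index : ℚ) ^ 2 * (W.torsionOrder : ℚ) ^ 2 /
      (((W.baseChange ℝ).numRealComponents : ℚ) * (k : ℚ) ^ 2 *
        ((W.baseChange K).torsionOrder : ℚ) ^ 2 * (Dt.c : ℚ) ^ 2 *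
        (Units.torsionOrder K : ℚ) ^ 2 * qd * |(Cd.u : ℚ)| * (W.tamagawaProduct : ℚ)) with hq_def
  -- the valuation of the door's rational for a point with exponent `m`
  have hval : ∀ {m : ℕ} {Q : (W.baseChange K).toAffine.Point},
      P - (2 ^ m) • Q ∈ AddCommGroup.torsion (W.baseChange K).toAffine.Point →
      (¬ ∃ Q' : (W.baseChange K).toAffine.Point,
          Q - 2 • Q' ∈ AddCommGroup.torsion (W.baseChange K).toAffine.Point) →
      padicValRat 2 q =
        3 + 2 * (m : ℤ) - (padicValRat 2 ((W.baseChange ℝ).numRealComponents : ℚ) + 2 + 2 * (padicValInt 2 Dt.c : ℤ) +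
          ((padicValNat 2 (Nat.card (AddCommGroup.primaryComponent Wd.sha 2)) : ℤ) +
            ((transpCount W (NumberField.discr K) : ℤ) + 2 * (identCount W (NumberField.discr K) : ℤ)))) := by
    intro m Q hPQ hQ
    obtain ⟨hI0, hvIdx⟩ := padicValNat_index_of_twoDivisibility (W.baseChange K) hgK hgenK hPQ hQ
    have hI' : ((AddSubgroup.zmultiples P).index : ℚ) ≠ 0 := by exact_mod_cast hI0
    have hvI : padicValRat 2 ((AddSubgroup.zmultiples P).index : ℚ) = (m : ℤ) := by
      rw [padicValRat.of_nat, hvIdx, hvtK]; push_cast; ring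
    have hA1 : (8 : ℚ) * ((AddSubgroup.zmultiples P).index : ℚ) ^ 2 ≠ 0 :=
      mul_ne_zero (by norm_num) (pow_ne_zero _ hI')
    have hA2 : (8 : ℚ) * ((AddSubgroup.zmultiples P).index : ℚ) ^ 2 * (W.torsionOrder : ℚ) ^ 2 ≠ 0 :=
      mul_ne_zero hA1 (pow_ne_zero _ htW')
    have hnum : padicValRat 2 ((8 : ℚ) * ((AddSubgroup.zmultiples P).index : ℚ) ^ 2 * (W.torsionOrder : ℚ) ^ 2) =
        3 + 2 * (m : ℤ) := by
      rw [padicValRat.mul hA1 (pow_ne_zero _ htW'), padicValRat.mul (by norm_num) (pow_ne_zero _ hI'),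
        padicValRat.pow, padicValRat.pow, h8, hvI, hvtW]
      ring
    rw [hq_def, padicValRat.div hA2 hD7, hnum, hden]
  ------------------------------------------------------------------ the existence of the exponent and the non-vanishing of `q`
  obtain ⟨m₀, Q₀, hPQ₀, hQ₀⟩ := exists_twoDivisibility_of_rankOne (W.baseChange K) hgenK huniqK hPinf
  have hq0 : q ≠ 0 := by
    intro h0
    rw [h0, Rat.cast_zero] at hshaW
    exact hshaW_ne hshaW
  refine ⟨hfinW, hfind, hrkK, hPinf, ⟨m₀, Q₀, hPQ₀, hQ₀⟩,
    fun m m' hm hm' => hasTwoDivisibilityUpToTorsion_unique W K hrkK P hm hm', q, hshaW, hq0, ?_⟩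
  rintro m ⟨Q, hPQ, hQ⟩
  have hQ' : ¬ ∃ Q' : (W.baseChange K).toAffine.Point,
      Q - 2 • Q' ∈ AddCommGroup.torsion (W.baseChange K).toAffine.Point := hQ
  rw [hval hPQ hQ']
  have hv' := hsign
  push_cast at hv' ⊢
  linarith

end Summit.BirchSwinnertonDyer.BirchSwinnertonDyer.Theorems.RankOneAtTwoOneDoor

end
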